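import Summits.ValiantsHypothesis.ValiantsHypothesis.Theorems.GrenetZeonDualUnipotentThreeHalvesHeavyTopThmCLemmaRa
import Summits.ValiantsHypothesis.ValiantsHypothesis.Theorems.GrenetZeonDualUnipotentThreeHalvesHeavyTopThmCLemmaRb
import Summits.ValiantsHypothesis.ValiantsHypothesis.Theorems.GrenetZeonDualUnipotentThreeHalvesHeavyTopThmCRegularShift
import Summits.ValiantsHypothesis.ValiantsHypothesis.Theorems.GrenetZeonDualUnipotentThreeHalvesHeavyTopTorusInitial
import Summits.ValiantsHypothesis.ValiantsHypothesis.Theorems.GrenetZeonDualUnipotentThreeHalvesHeavyTopConjTransport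
import Summits.ValiantsHypothesis.ValiantsHypothesis.Theorems.GrenetZeonDualUnipotentThreeHalvesHeavyTopIotaOfThmC
import Summits.ValiantsHypothesis.ValiantsHypothesis.Theorems.GrenetZeonDualUnipotentThreeHalvesHeavyTopCompositionBoundGeneral

/-!
# `GrenetZeon.DualUnipotentThreeHalves` (stmt-ValiantsHypothesis-24318), R2 heavy-top instrument — ★★★ THEOREM C FOR EVERY `n ≥ 4` IN THE KERNEL:
# a nilpotent subspace of `M_n(ℂ)` of dimension `C(n,2) − 1` containing a regular nilpotent is reducible; `ι(n) ≤ C(n,2) − 2` for all `n ≥ 4`;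
# the census cell `(10,14)` is TRUE unconditionally

Experiment cell «val-heavytop-census» (D-0160), engine seat val-htc-eng-1 g5.  Uniform (all `n`) version of ✓ `…HeavyTopThmCSeven` / `…ThmC6` / `…ThmC5`
(eng-1 g4: count + generated certificates for `n ≤ 7`), following val-idea-30's MEMO codim-one rev 1.2 with the kernel simplifications of files 1–5
(✓ `…ThmCBandCalculus`, `…ThmCLinAlg`, `…ThmCIdentities`, `…ThmCLemmaRa`, `…ThmCLemmaRb`):

conjugate the regular element to the shift `J`; take the graded limit `W` (✓ `HeavyTopTorusInitial`); the trace-orthogonality COUNT leaves at most one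
deficient height `h⋆` (✓ `exists_deficient_height`); let `s` be the lowest weight of `W`.  `s = 0` ⇒ `V ⊆ 𝔟` ⇒ `ℂe₀` invariant.  Otherwise:
THEOREM B (`J^s ∈ W`, `T_{2s} ⊆ W` ⇒ `N_s = 0`) unless `h⋆ = s` (LEMMA R-a: impossible for `s ≥ 2`; `s = 1` has `J ∈ W`) or `h⋆ = 2s < n` with `P_{2s}`
a hyperplane (LEMMA R-b: `N_s = ℂ(e_a − e_{a+s})`, impossible for `s ≥ 2`; for `s = 1` THEOREM A: every member of `V` has sub-diagonal part in
`ℂ(E_{a+1,a} − E_{a+2,a+1})` and nothing lower, so `span(e_0,…,e_c)` is invariant for `c ∈ {0, 2} ∖ {a, a+1}`).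

* ★★★ `thmC_shift`, `thmC` — THEOREM C for every `n ≥ 4` (resp. in the `Fin (s+1)`, `s ≥ 3` shape of ✓ `finrank_le_of_thmC`);
* ★★★ `iota_le` — `ι(s+1) ≤ C(s+1,2) − 2` for every `s ≥ 3`: NO irreducible nilpotent subspace has Gerstenhaber deficiency one;
* ★ `iota_fourteen_le`, ★★ `heavyTopInst_ten_fourteen : HeavyTopInst 10 14` — the census cell `(10,14)` (GRID v1.5: ✓ᵐʰ) is KERNEL, unconditional
  (✓ `heavyTopInst_of_iota_bound'` with the one datum `ι(14) ≤ 89`).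

Honest framing: Theorem C is a deficiency-one supplement to Gerstenhaber's theorem (val-idea-30 found no printed statement; MOR 1991 / dSP 2013 treat the
equality case); here it is a calibration row of the census instrument and ONE more `C₀ = 1` cell.  Nothing here proves or refutes `HeavyTopLaw`/`HeavyTopSlowLaw`,
24318, S3 or 8062; `VP ≠ VNP` is NOT proved.  No definitions.  [val-idea-30 MEMO codim-one rev 1.2 (paper proof, all m); lead g0 ROADMAP-codim1; this seat: kernel]
-/

noncomputable section

-- single-conjunct layout: Sub = Summit, duplicated namespace component intended
set_option linter.dupNamespace false

namespace Summit.ValiantsHypothesis.ValiantsHypothesis.Theorems.GrenetZeon.HeavyTopThmCUniform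

open Matrix
open Summit.ValiantsHypothesis.ValiantsHypothesis.Theorems.GrenetZeon.HeavyTopThmCnGradedCount (dot_eq_zero dot_one_eq_zero finrank_add_le finrank_add_succ_le finrank_le_sum_range)
open Summit.ValiantsHypothesis.ValiantsHypothesis.Theorems.GrenetZeon.HeavyTopThmCnStructure (jpow_mem unit_mem lower_band_mem map_eq_top_of_finrank below_of_initial not_irreducible_of_column_strip)
open Summit.ValiantsHypothesis.ValiantsHypothesis.Theorems.GrenetZeon.HeavyTopThmCRegularShift (exists_isUnit_conj_eq_fullShift)
open Summit.ValiantsHypothesis.ValiantsHypothesis.Theorems.GrenetZeon.HeavyTopTorusInitial (exists_torus_initial_subspace_of_isNilpotent pow_eq_zero_of_isNilpotent)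
open Summit.ValiantsHypothesis.ValiantsHypothesis.Theorems.GrenetZeon.HeavyTopConjTransport (exists_conj_subspace not_irreducible_of_conj)
open Summit.ValiantsHypothesis.ValiantsHypothesis.Theorems.GrenetZeon.HeavyTopIotaOfThmC (finrank_le_of_thmC)
open Summit.ValiantsHypothesis.ValiantsHypothesis.Theorems.GrenetZeon.HeavyTopThmCLinAlg (exists_deficient_height exists_vec_of_finrank_succ)
open Summit.ValiantsHypothesis.ValiantsHypothesis.Theorems.GrenetZeon.HeavyTopThmCIdentities (sq_eq_zero_of_unit_mem)
open Summit.ValiantsHypothesis.ValiantsHypothesis.Theorems.GrenetZeon.HeavyTopThmCLemmaRa (theoremB lemmaRa)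
open Summit.ValiantsHypothesis.ValiantsHypothesis.Theorems.GrenetZeon.HeavyTopThmCLemmaRb (shape kill)
open Summit.ValiantsHypothesis.ValiantsHypothesis.Theorems.GrenetZeon.RadicalSplit (HeavyTopInst)
open Summit.ValiantsHypothesis.ValiantsHypothesis.Theorems.GrenetZeon.HeavyTopCompositionBound (heavyTopInst_of_iota_bound')

/-! ## Theorem C with the shift inside -/

set_option maxHeartbeats 1600000 in
/-- ★★★ **THEOREM C (all `n ≥ 4`), normalised form.**  A linear space of nilpotent `n × n` complex matrices of dimension `C(n,2) − 1` containing the shift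
`J` has a non-trivial proper invariant subspace. [val-idea-30 MEMO codim-one THEOREM C; this seat: uniform kernel port] -/
theorem thmC_shift {n : ℕ} (hn : 4 ≤ n) (V : Submodule ℂ (Matrix (Fin n) (Fin n) ℂ)) (hV : ∀ A ∈ V, IsNilpotent A)
    (hdim : Module.finrank ℂ V = n.choose 2 - 1)
    (hJV : (Matrix.of fun a b : Fin n => if (b : ℕ) = (a : ℕ) + 1 then (1 : ℂ) else 0) ∈ V) :
    ¬ ∀ U : Submodule ℂ (Fin n → ℂ), (∀ A ∈ V, ∀ x ∈ U, A *ᵥ x ∈ U) → U = ⊥ ∨ U = ⊤ := by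
  classical
  -- the graded limit along `diag(t^{n-1}, …, t^0)`
  obtain ⟨W, hWdim, hWgr', hWinit', -, hWnil, -⟩ := exists_torus_initial_subspace_of_isNilpotent (fun a : Fin n => (n - 1) - (a : ℕ)) V hV
  have projEq : ∀ (A : Matrix (Fin n) (Fin n) ℂ) (d : ℤ),
      (Matrix.of fun a b : Fin n => if (b : ℤ) - (a : ℤ) = d then A a b else 0) =
      (Matrix.of fun a b : Fin n => if (((fun a : Fin n => (n - 1) - (a : ℕ)) a : ℕ) : ℤ) - (((fun a : Fin n => (n - 1) - (a : ℕ)) b : ℕ) : ℤ) = d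
        then A a b else 0) := by
    intro A d; ext a b; simp only [Matrix.of_apply]
    have ha := a.isLt; have hb := b.isLt
    split_ifs with h1 h2 h2 <;> first | rfl | (exfalso; omega)
  have hgr : ∀ A ∈ W, ∀ d : ℤ, (Matrix.of fun a b : Fin n => if (b : ℤ) - (a : ℤ) = d then A a b else 0) ∈ W := by
    intro A hA d; rw [projEq]; exact hWgr' A hA d
  have hinit : ∀ Z ∈ V, ∀ d : ℤ, (∀ a b : Fin n, (b : ℤ) - (a : ℤ) < d → Z a b = 0) →
      (Matrix.of fun a b : Fin n => if (b : ℤ) - (a : ℤ) = d then Z a b else 0) ∈ W := by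
    intro Z hZ d hlow; rw [projEq]
    exact hWinit' Z hZ d (fun a b hab => hlow a b (by have ha := a.isLt; have hb := b.isLt; omega))
  -- `J ∈ W`
  have hJW : (Matrix.of fun a b : Fin n => if (b : ℕ) = (a : ℕ) + 1 then (1 : ℂ) else 0) ∈ W := by
    have h1 := hinit _ hJV 1 (fun a b hab => by rw [Matrix.of_apply, if_neg]; omega)
    have e : (Matrix.of fun a b : Fin n => if (b : ℤ) - (a : ℤ) = (1 : ℤ) then
        (Matrix.of fun a b : Fin n => if (b : ℕ) = (a : ℕ) + 1 then (1 : ℂ) else 0) a b else 0) =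
        (Matrix.of fun a b : Fin n => if (b : ℕ) = (a : ℕ) + 1 then (1 : ℂ) else 0) := by
      ext a b; simp only [Matrix.of_apply]
      by_cases hb : (b : ℕ) = (a : ℕ) + 1
      · rw [if_pos (by omega), if_pos hb]
      · rw [if_neg hb]; split_ifs <;> rfl
    rw [e] at h1; exact h1
  -- the diagonal-extraction maps
  let dp : ∀ h : ℕ, Matrix (Fin n) (Fin n) ℂ →ₗ[ℂ] (Fin (n - h) → ℂ) := fun h =>
    LinearMap.pi fun i : Fin (n - h) => Matrix.entryLinearMap ℂ ℂ (⟨(i : ℕ), by omega⟩ : Fin n) (⟨(i : ℕ) + h, by omega⟩ : Fin n)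
  let dm : ∀ h : ℕ, Matrix (Fin n) (Fin n) ℂ →ₗ[ℂ] (Fin (n - h) → ℂ) := fun h =>
    LinearMap.pi fun i : Fin (n - h) => Matrix.entryLinearMap ℂ ℂ (⟨(i : ℕ) + h, by omega⟩ : Fin n) (⟨(i : ℕ), by omega⟩ : Fin n)
  have hdp : ∀ h A (i : Fin (n - h)) (a b : Fin n), (a : ℕ) = i → (b : ℕ) = i + h → dp h A i = A a b := by
    intro h A i a b ha hb
    obtain ⟨a, ha'⟩ := a
    obtain ⟨b, hb'⟩ := b
    simp only at ha hb
    subst ha; subst hb; rfl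
  have hdm : ∀ h A (i : Fin (n - h)) (a b : Fin n), (a : ℕ) = i + h → (b : ℕ) = i → dm h A i = A a b := by
    intro h A i a b ha hb
    obtain ⟨a, ha'⟩ := a
    obtain ⟨b, hb'⟩ := b
    simp only at ha hb
    subst ha; subst hb; rfl
  -- orthogonality, sums, bounds, count
  have hPN : ∀ h, ∀ q ∈ W.map (dm h), ∀ p ∈ W.map (dp h), q ⬝ᵥ p = 0 :=
    fun h => dot_eq_zero W hWnil hgr h (dp h) (dm h) (hdp h) (hdm h)
  have hN1 : ∀ h, ∀ q ∈ W.map (dm h), q ⬝ᵥ (fun _ => (1 : ℂ)) = 0 :=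
    fun h => dot_one_eq_zero W hWnil hgr hJW h (dm h) (hdm h)
  have hb : ∀ h, Module.finrank ℂ (W.map (dp h)) + Module.finrank ℂ (W.map (dm h)) ≤ n - h :=
    fun h => finrank_add_le h _ _ (hPN h)
  have hb' : ∀ h, (fun _ => (1 : ℂ)) ∉ W.map (dp h) →
      Module.finrank ℂ (W.map (dp h)) + Module.finrank ℂ (W.map (dm h)) + 1 ≤ n - h :=
    fun h hone => finrank_add_succ_le h _ _ (hPN h) (hN1 h) hone
  have hcount := finrank_le_sum_range W hWnil hgr dp dm hdp hdm
  rw [hWdim, hdim] at hcount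
  have hchoose : 1 ≤ n.choose 2 := Nat.succ_le_of_lt (Nat.choose_pos (by omega))
  -- at most one deficient height
  obtain ⟨hstar, hkey, hlow⟩ := exists_deficient_height n (fun h => Module.finrank ℂ (W.map (dp h)))
    (fun h => Module.finrank ℂ (W.map (dm h))) (fun h => (fun _ => (1 : ℂ)) ∉ W.map (dp h))
    (fun h _ _ => hb h) (fun h _ _ hbad => hb' h hbad) (by omega)
  -- the lowest weight
  obtain ⟨s, hs⟩ : ∃ s, Nat.findGreatest (fun h => W.map (dm h) ≠ ⊥) (n - 1) = s := ⟨_, rfl⟩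
  obtain ⟨hsn, hsP, hsmax⟩ := Nat.findGreatest_eq_iff.1 hs
  have hNabove : ∀ h, s < h → h < n → W.map (dm h) = ⊥ := fun h h1 h2 => not_not.1 (hsmax h1 (by omega))
  have hbelow := below_of_initial V W hinit dm hdm s hNabove
  -- letters available off the deficient height
  have hJpow : ∀ h : ℕ, 1 ≤ h → h ≤ n - 1 → h ≠ hstar →
      (Matrix.of fun a b : Fin n => if (b : ℕ) = (a : ℕ) + h then (1 : ℂ) else 0) ∈ W :=
    fun h h1 h2 hne => jpow_mem W hgr h (dp h) (hdp h) (by have := (hkey h h1 h2 hne).2; push Not at this; exact this)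
  have hUnit : ∀ i j : ℕ, j ≤ n - 1 → i + s < j → j - i ≠ hstar →
      (Matrix.of fun a b : Fin n => if (a : ℕ) = i ∧ (b : ℕ) = j then (1 : ℂ) else 0) ∈ W := by
    intro i j hj hij hne
    obtain ⟨gsum, -⟩ := hkey (j - i) (by omega) (by omega) hne
    have hNbot : W.map (dm (j - i)) = ⊥ := hNabove (j - i) (by omega) (by omega)
    rw [hNbot, finrank_bot, add_zero] at gsum
    have hPtop : W.map (dp (j - i)) = ⊤ := map_eq_top_of_finrank (j - i) _ gsum
    have hmem : Pi.single (⟨i, by omega⟩ : Fin (n - (j - i))) (1 : ℂ) ∈ W.map (dp (j - i)) := by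
      rw [hPtop]; exact Submodule.mem_top
    have h1 := unit_mem W hgr (j - i) (dp (j - i)) (hdp (j - i)) ⟨i, by omega⟩ hmem
    have e : (Matrix.of fun a b : Fin n => if (a : ℕ) = i ∧ (b : ℕ) = j then (1 : ℂ) else 0) =
        (Matrix.of fun a b : Fin n => if (a : ℕ) = ((⟨i, by omega⟩ : Fin (n - (j - i))) : ℕ) ∧
          (b : ℕ) = ((⟨i, by omega⟩ : Fin (n - (j - i))) : ℕ) + (j - i) then (1 : ℂ) else 0) := by
      ext a b; simp only [Matrix.of_apply]
      have hij' : i + (j - i) = j := by omega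
      rw [hij']
    rw [e]; exact h1
  -- case `s = 0`: every member of `V` is upper triangular
  rcases Nat.eq_zero_or_pos s with hs0 | hspos
  · subst hs0
    exact not_irreducible_of_column_strip V 0 (by omega) (fun X hX a b hb0 ha => hbelow X hX a b (by omega))
  -- `s ≥ 1`; `s ≤ n − 2` (the weight-`(n−1)` piece is zero by the zero sum)
  have hsne : W.map (dm s) ≠ ⊥ := hsP (by omega)
  have hs2 : s + 2 ≤ n := by
    by_contra hlt
    have hs1 : s = n - 1 := by omega
    apply hsne
    rw [Submodule.eq_bot_iff]
    intro q hq
    funext i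
    have h1 := hN1 s q hq
    rw [dotProduct, Finset.sum_eq_single i (fun j _ hj => absurd (Fin.ext (by have := j.isLt; have := i.isLt; omega) : j = i) hj)
      (fun h => absurd (Finset.mem_univ i) h), mul_one] at h1
    exact h1
  -- THEOREM B: `J^s ∈ W` and `T_{2s} ⊆ W` kill `N_s`
  have hB : (Matrix.of fun a b : Fin n => if (b : ℕ) = (a : ℕ) + s then (1 : ℂ) else 0) ∈ W →
      (∀ i : ℕ, i + 2 * s < n → (Matrix.of fun a b : Fin n => if (a : ℕ) = i ∧ (b : ℕ) = i + 2 * s then (1 : ℂ) else 0) ∈ W) → False := by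
    intro hJs hT
    apply hsne
    rw [Submodule.eq_bot_iff]
    rintro _ ⟨B, hB, rfl⟩
    have hY := lower_band_mem W hgr s (dm s) (hdm s) B hB (fun i : Fin n => if hi : (i : ℕ) < n - s then dm s B ⟨(i : ℕ), hi⟩ else 0)
      (fun i => by simp only [dif_pos (show (i : ℕ) < n - s from i.isLt)])
    have hz := theoremB W hWnil hspos _ hJs hY (fun b hb => sq_eq_zero_of_unit_mem W hWnil s _ (b : ℕ) hb (hT b hb) hY)
    funext i
    have := hz ⟨(i : ℕ), by omega⟩ (by dsimp only; omega)
    simpa [dif_pos i.isLt] using this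
  have hJs_of : s ≠ hstar → (Matrix.of fun a b : Fin n => if (b : ℕ) = (a : ℕ) + s then (1 : ℂ) else 0) ∈ W := fun hne => by
    rcases Nat.lt_or_ge s 2 with h1 | h1
    · have : s = 1 := by omega
      subst this; exact hJW
    · exact hJpow s (by omega) (by omega) hne
  have hT_of : 2 * s ≠ hstar → ∀ i : ℕ, i + 2 * s < n →
      (Matrix.of fun a b : Fin n => if (a : ℕ) = i ∧ (b : ℕ) = i + 2 * s then (1 : ℂ) else 0) ∈ W := fun hne i hi => by
    have h := hUnit i (i + 2 * s) (by omega) (by omega) (by rw [show i + 2 * s - i = 2 * s by omega]; exact hne)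
    exact h
  by_cases hA : s ≠ hstar ∧ 2 * s ≠ hstar
  · exact (hB (hJs_of hA.1) (hT_of hA.2)).elim
  rw [not_and_or, not_not, not_not] at hA
  rcases hA with hSs | hS2
  · -- `h⋆ = s`: `s = 1` is THEOREM B with `J ∈ W`; `s ≥ 2` is LEMMA R-a
    rcases Nat.lt_or_ge s 2 with h1 | h2
    · have hs1 : s = 1 := by omega
      exact (hB (by rw [hs1]; exact hJW) (hT_of (by omega))).elim
    · obtain ⟨g1, -⟩ := hkey 1 (le_refl 1) (by omega) (by omega)
      exact (lemmaRa W hWnil hgr dp dm hdp hdm hJW h2 (hN1 s) (hlow s (by omega) (by omega))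
        (hPN 1) g1 (hT_of (by omega)) (fun i hi => hUnit i (i + (s + 1)) (by omega) (by omega)
          (by rw [show i + (s + 1) - i = s + 1 by omega]; omega)) hsne).elim
  · -- `h⋆ = 2s`
    have hJs : (Matrix.of fun a b : Fin n => if (b : ℕ) = (a : ℕ) + s then (1 : ℂ) else 0) ∈ W := hJs_of (by omega)
    by_cases h2sn : n ≤ 2 * s
    · exact (hB hJs (fun i hi => by exfalso; omega)).elim
    have h2s : 2 * s < n := by omega
    -- `P_{2s}` is everything (THEOREM B again) or a hyperplane
    have hN2s : W.map (dm (2 * s)) = ⊥ := hNabove (2 * s) (by omega) h2s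
    have hlow2 := hlow (2 * s) (by omega) (by omega)
    rw [hN2s, finrank_bot, add_zero] at hlow2
    by_cases htop : Module.finrank ℂ (W.map (dp (2 * s))) = n - 2 * s
    · have hPtop : W.map (dp (2 * s)) = ⊤ := map_eq_top_of_finrank (2 * s) _ htop
      refine (hB hJs (fun i hi => ?_)).elim
      have hmem : Pi.single (⟨i, by omega⟩ : Fin (n - 2 * s)) (1 : ℂ) ∈ W.map (dp (2 * s)) := by rw [hPtop]; exact Submodule.mem_top
      exact unit_mem W hgr (2 * s) (dp (2 * s)) (hdp (2 * s)) ⟨i, by omega⟩ hmem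
    have hb2 := hb (2 * s)
    rw [hN2s, finrank_bot, add_zero] at hb2
    obtain ⟨u, hu0, hPu⟩ := exists_vec_of_finrank_succ (W.map (dp (2 * s))) (by omega)
    obtain ⟨gs, -⟩ := hkey s (by omega) (by omega) (by omega)
    obtain ⟨a, ha, hmem, hline⟩ := shape W hWnil hgr dp dm hdp hdm hspos h2s hJs (hPN s) gs (hN1 s) u hu0 hPu hsne
    rcases Nat.lt_or_ge s 2 with h1 | h2
    · -- `s = 1`: THEOREM A — the sub-diagonal part of `V` lives in `ℂ(E_{a+1,a} − E_{a+2,a+1})`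
      have hs1 : s = 1 := by omega
      subst hs1
      have hentry : ∀ X ∈ V, ∀ (m : Fin (n - 1)) (p q : Fin n), (p : ℕ) = m + 1 → (q : ℕ) = m →
          X p q = dm 1 (Matrix.of fun a b : Fin n => if (b : ℤ) - (a : ℤ) = (-1 : ℤ) then X a b else 0) m := by
        intro X hX m p q hp hq
        rw [hdm 1 _ m p q hp hq, Matrix.of_apply, if_pos (by omega)]
      have hXW : ∀ X ∈ V, (Matrix.of fun a b : Fin n => if (b : ℤ) - (a : ℤ) = (-1 : ℤ) then X a b else 0) ∈ W :=
        fun X hX => hinit X hX (-1) (fun a b hab => hbelow X hX a b (by omega))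
      have hsub : ∀ X ∈ V, ∀ (m : Fin (n - 1)), (m : ℕ) ≠ a → (m : ℕ) ≠ a + 1 → ∀ p q : Fin n, (p : ℕ) = m + 1 → (q : ℕ) = m → X p q = 0 := by
        intro X hX m hma hma1 p q hp hq
        rw [hentry X hX m p q hp hq]
        obtain ⟨t, ht⟩ := hline _ ⟨_, hXW X hX, rfl⟩
        rw [ht]
        simp only [Pi.smul_apply, Pi.sub_apply, Pi.single_apply, Fin.ext_iff, if_neg hma, show ¬ ((m : ℕ) = a + 1) from hma1,
          if_false, sub_zero, smul_zero]
      by_cases ha0 : a = 0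
      · refine not_irreducible_of_column_strip V 2 (by omega) (fun X hX p q hq2 hp => ?_)
        by_cases hlt : (q : ℕ) + 1 < (p : ℕ)
        · exact hbelow X hX p q hlt
        · exact hsub X hX ⟨2, by omega⟩ (by simp [ha0]) (by simp [ha0]) p q (by simp; omega) (by simp; omega)
      · refine not_irreducible_of_column_strip V 0 (by omega) (fun X hX p q hq0 hp => ?_)
        by_cases hlt : (q : ℕ) + 1 < (p : ℕ)
        · exact hbelow X hX p q hlt
        · exact hsub X hX ⟨0, by omega⟩ (by simp; omega) (by simp) p q (by simp; omega) (by simp; omega)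
    · -- `s ≥ 2`: LEMMA R-b
      obtain ⟨g1, -⟩ := hkey 1 (le_refl 1) (by omega) (by omega)
      exact (kill W hWnil hgr dp dm hdp hdm hJW h2 a ha hmem (hPN 1) g1
        (fun i hi => hUnit i (i + (s + 1)) (by omega) (by omega) (by rw [show i + (s + 1) - i = s + 1 by omega]; omega))).elim

/-- ★★★ **THEOREM C (every `s ≥ 3`, the `Fin (s+1)` shape of ✓ `finrank_le_of_thmC`).**  A linear space of nilpotent `(s+1) × (s+1)` complex matrices of
dimension `C(s+1,2) − 1` containing a regular nilpotent (`Z^s ≠ 0`) has a non-trivial proper invariant subspace.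
[val-idea-30 MEMO codim-one THEOREM C (paper, all m); lead g0 ROADMAP-codim1; this seat: uniform kernel port] -/
theorem thmC {s : ℕ} (hs : 3 ≤ s) : ∀ V : Submodule ℂ (Matrix (Fin (s + 1)) (Fin (s + 1)) ℂ), (∀ A ∈ V, IsNilpotent A) →
    Module.finrank ℂ V = (s + 1).choose 2 - 1 → (∃ Z ∈ V, Z ^ s ≠ 0) →
    ¬ ∀ U : Submodule ℂ (Fin (s + 1) → ℂ), (∀ A ∈ V, ∀ x ∈ U, A *ᵥ x ∈ U) → U = ⊥ ∨ U = ⊤ := by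
  intro V hV hdim hZ
  obtain ⟨Z, hZV, hZs⟩ := hZ
  have hZn : Z ^ (s + 1) = 0 := pow_eq_zero_of_isNilpotent Z (hV Z hZV)
  obtain ⟨P, hP, hPZ⟩ := exists_isUnit_conj_eq_fullShift (m := s) Z hZn hZs
  obtain ⟨V', hV'dim, hVV', -, -, hV'pow⟩ := exists_conj_subspace P hP V
  have hV'nil : ∀ A ∈ V', IsNilpotent A := fun A hA =>
    ⟨s + 1, hV'pow (s + 1) (fun Z hZ => pow_eq_zero_of_isNilpotent Z (hV Z hZ)) A hA⟩
  have hJ : (Matrix.of fun a b : Fin (s + 1) => if (b : ℕ) = (a : ℕ) + 1 then (1 : ℂ) else 0) ∈ V' := by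
    rw [← hPZ]; exact hVV' Z hZV
  exact not_irreducible_of_conj P hP V V' hVV' (thmC_shift (by omega) V' hV'nil (hV'dim.trans hdim) hJ)

/-- ★★★ **`ι(s+1) ≤ C(s+1,2) − 2` for every `s ≥ 3`**: no irreducible linear space of nilpotent `(s+1) × (s+1)` complex matrices has Gerstenhaber deficiency
one (✓ `finrank_le_of_thmC` ∘ `thmC`; the MMS nil-index bound supplies the regular element, the Q1 theorem excludes type `(s,1)`). [this cell] -/
theorem iota_le {s : ℕ} (hs : 3 ≤ s) (V : Submodule ℂ (Matrix (Fin (s + 1)) (Fin (s + 1)) ℂ)) (hV : ∀ A ∈ V, IsNilpotent A)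
    (hirr : ∀ U : Submodule ℂ (Fin (s + 1) → ℂ), (∀ A ∈ V, ∀ x ∈ U, A *ᵥ x ∈ U) → U = ⊥ ∨ U = ⊤) :
    Module.finrank ℂ V ≤ (s + 1).choose 2 - 2 :=
  finrank_le_of_thmC hs (thmC hs) V hV hirr

/-- ★ **`ι(14) ≤ 89`** (the single datum of the census cell `(10,14)`). [this cell] -/
theorem iota_fourteen_le (V : Submodule ℂ (Matrix (Fin 14) (Fin 14) ℂ)) (hV : ∀ A ∈ V, IsNilpotent A)
    (hirr : ∀ U : Submodule ℂ (Fin 14 → ℂ), (∀ A ∈ V, ∀ x ∈ U, A *ᵥ x ∈ U) → U = ⊥ ∨ U = ⊤) : Module.finrank ℂ V ≤ 89 := by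
  have h := iota_le (s := 13) (by norm_num) V hV hirr
  have e : (13 + 1).choose 2 - 2 = 89 := by decide
  rw [e] at h
  exact h

/-- ★★ **`HeavyTopInst 10 14`** — every affine nilpotent `14 × 14` pencil over `ℂ^{10×10}` is flag-cheap (heavy-top or not): the census cell `(10,14)`
(GRID v1.5: ✓ᵐʰ by the composition ledger, val-idea-30 g12 / lead g4) is KERNEL, UNCONDITIONAL — cuts cost `≤ 87`, `(1,13)/(13,1)` `97`, `(1,12,1)` `95`,
`(14)` `10 + ι(14) ≤ 99 < 100`.  ONE instance of R2; nothing about `HeavyTopLaw` / 24318 follows. [this cell] -/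
theorem heavyTopInst_ten_fourteen : HeavyTopInst 10 14 :=
  heavyTopInst_of_iota_bound' (by norm_num) 89 (by decide) (by decide) (by decide) (by decide) iota_fourteen_le

end Summit.ValiantsHypothesis.ValiantsHypothesis.Theorems.GrenetZeon.HeavyTopThmCUniform

end
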